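import Mathlib
import Literature.Analysis.PDE.Wave1DFarDuhamelComparison
import Literature.Analysis.PDE.Wave1DFarEnergySourced
import HarnessLib

/-!
# Far-side comparison of channel energies: both time directions, limits, and splitting

Analysis/PDE support file (everything proved), companions of `Wave1DFarDuhamelComparison.lean`
for the far-side channel estimate of `FixedModeChannels` (route PhotonSphereChannels,
stmt-FinalStateConjecture-10048):

* `wave1D_far_duhamel_comparison_abs` — the comparison
  `∫_{x>1+|t|} e_{V₀}[φ₀](t) ≤ 2(1+ε')∫_{x>1+|t|} e_P[φ](t) + 8δ²E₀/(σ−1)²` for ALL `t` (time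
  reversal `t ↦ −t` preserves both equations, the data relation and the energies);
* `wave1D_far_limits_comparison` — the same inequality between the limits of the two exterior
  energies as `t → ±∞` when they exist;
* `wave1D_farEnergy_lintegral_sub_le` — the pointwise splitting
  `∫⁻ e[ψ − k](t) ≤ 2∫⁻ e[ψ](t) + 2∫⁻ e[k](t)` of lower Lebesgue exterior energies for two `C²`
  functions (no equation needed), used to compare the channel energy of `ψ − k` with that of
  `ψ` when `k` is non-radiative.
Folklore.
-/

noncomputable section

namespace Literature.Analysis.PDE

open MeasureTheory Set Filter Topology intervalIntegral Real

variable {V₀ P : ℝ → ℝ} {φ φ₀ Fφ F₀ : ℝ → ℝ → ℝ}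

section
variable (hV₀ : Continuous V₀) (hV₀0 : ∀ x, 0 ≤ V₀ x) (hP : Continuous P) (hP0 : ∀ x, 0 ≤ P x)
  (hφ : ContDiff ℝ 2 (Function.uncurry φ)) (hFφ : Continuous (Function.uncurry Fφ))
  (hφsol : ∀ t x, iteratedDeriv 2 (fun τ => φ τ x) t - iteratedDeriv 2 (φ t) x + P x * φ t x
    = Fφ t x)
  (hFφ0 : ∀ τ x, 1 ≤ x → Fφ τ x = 0)
  (hφ₀ : ContDiff ℝ 2 (Function.uncurry φ₀)) (hF₀ : Continuous (Function.uncurry F₀))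
  (hφ₀sol : ∀ t x, iteratedDeriv 2 (fun τ => φ₀ τ x) t - iteratedDeriv 2 (φ₀ t) x + V₀ x * φ₀ t x
    = F₀ t x)
  (hF₀0 : ∀ τ x, 1 ≤ x → F₀ τ x = 0)
  (hdata : ∀ x, φ₀ 0 x = φ 0 x ∧ deriv (fun τ => φ₀ τ x) 0 = deriv (fun τ => φ τ x) 0)
  {δ σ ε' : ℝ} (hδ : 0 ≤ δ) (hσ : 1 < σ) (hε' : 0 ≤ ε')
  (hq : ∀ x, 1 ≤ x → (V₀ x - P x) ^ 2 ≤ δ ^ 2 * x ^ (-(2 * σ)) * P x)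
  (hVP : ∀ x, 1 ≤ x → V₀ x ≤ (1 + ε') * P x)
  (hfin : ∫⁻ x in Ioi 1, ENNReal.ofReal
    (deriv (fun τ => φ τ x) 0 ^ 2 + deriv (φ 0) x ^ 2 + P x * φ 0 x ^ 2) < ⊤)
include hV₀ hV₀0 hP hP0 hφ hFφ hφsol hFφ0 hφ₀ hF₀ hφ₀sol hF₀0 hdata hδ hσ hε' hq hVP hfin

/-- **Far-side Duhamel comparison, all times.** [folklore] -/
theorem wave1D_far_duhamel_comparison_abs (t : ℝ) :
    IntegrableOn (fun x => deriv (fun τ => φ₀ τ x) t ^ 2 + deriv (φ₀ t) x ^ 2 + V₀ x * φ₀ t x ^ 2)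
        (Ioi (1 + |t|)) ∧
      (∫ x in Ioi (1 + |t|),
          (deriv (fun τ => φ₀ τ x) t ^ 2 + deriv (φ₀ t) x ^ 2 + V₀ x * φ₀ t x ^ 2))
        ≤ 2 * (1 + ε') * (∫ x in Ioi (1 + |t|),
            (deriv (fun τ => φ τ x) t ^ 2 + deriv (φ t) x ^ 2 + P x * φ t x ^ 2))
          + 8 * δ ^ 2 / (σ - 1) ^ 2 * ∫ x in Ioi 1,
            (deriv (fun τ => φ τ x) 0 ^ 2 + deriv (φ 0) x ^ 2 + P x * φ 0 x ^ 2) := by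
  rcases le_total 0 t with ht | ht
  · rw [abs_of_nonneg ht]
    exact wave1D_far_duhamel_comparison hV₀ hV₀0 hP hP0 hφ hFφ hφsol hFφ0 hφ₀ hF₀ hφ₀sol hF₀0
      hdata hδ hσ hε' hq hVP hfin ht
  · -- time reversal
    obtain ⟨hφ', hφsol', he'⟩ := wave1D_timeReversal_source hφ hφsol
    obtain ⟨hφ₀', hφ₀sol', he₀'⟩ := wave1D_timeReversal_source hφ₀ hφ₀sol
    have hFφ' : Continuous (Function.uncurry fun t x => Fφ (-t) x) :=
      hFφ.comp (continuous_neg.prodMap continuous_id)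
    have hF₀' : Continuous (Function.uncurry fun t x => F₀ (-t) x) :=
      hF₀.comp (continuous_neg.prodMap continuous_id)
    have hdφ : ∀ x, DifferentiableAt ℝ (fun τ => φ τ x) 0 := fun x =>
      (contDiff_two_slices' hφ 0 x).1.differentiable (by norm_num) 0
    have hdφ₀ : ∀ x, DifferentiableAt ℝ (fun τ => φ₀ τ x) 0 := fun x =>
      (contDiff_two_slices' hφ₀ 0 x).1.differentiable (by norm_num) 0
    have hdata' : ∀ x, (fun t x => φ₀ (-t) x) 0 x = (fun t x => φ (-t) x) 0 x ∧
        deriv (fun τ => (fun t x => φ₀ (-t) x) τ x) 0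
          = deriv (fun τ => (fun t x => φ (-t) x) τ x) 0 := by
      intro x
      obtain ⟨h1, h2⟩ := hdata x
      refine ⟨by simpa using h1, ?_⟩
      show deriv (fun τ => φ₀ (-τ) x) 0 = deriv (fun τ => φ (-τ) x) 0
      rw [deriv_comp_neg (fun τ => φ₀ τ x) 0, deriv_comp_neg (fun τ => φ τ x) 0, neg_zero, h2]
    have hfin' : ∫⁻ x in Ioi 1, ENNReal.ofReal (deriv (fun τ => (fun t x => φ (-t) x) τ x) 0 ^ 2
        + deriv ((fun t x => φ (-t) x) 0) x ^ 2 + P x * (fun t x => φ (-t) x) 0 x ^ 2) < ⊤ := by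
      simp only [he', neg_zero]; exact hfin
    have h := wave1D_far_duhamel_comparison hV₀ hV₀0 hP hP0 hφ' hFφ' hφsol'
      (fun τ x hx => hFφ0 (-τ) x hx) hφ₀' hF₀' hφ₀sol' (fun τ x hx => hF₀0 (-τ) x hx) hdata'
      hδ hσ hε' hq hVP hfin' (t := -t) (by linarith)
    simp only [he', he₀', neg_neg, neg_zero] at h
    rw [abs_of_nonpos ht, ← sub_eq_add_neg]
    simpa [sub_eq_add_neg] using h

/-- **Comparison of the limits** of the two exterior energies (when they exist). [folklore] -/
theorem wave1D_far_limits_comparison {l : Filter ℝ} [l.NeBot] {Lp L : ℝ}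
    (hLp : Tendsto (fun t => ∫ x in Ioi (1 + |t|),
      (deriv (fun τ => φ₀ τ x) t ^ 2 + deriv (φ₀ t) x ^ 2 + V₀ x * φ₀ t x ^ 2)) l (𝓝 Lp))
    (hL : Tendsto (fun t => ∫ x in Ioi (1 + |t|),
      (deriv (fun τ => φ τ x) t ^ 2 + deriv (φ t) x ^ 2 + P x * φ t x ^ 2)) l (𝓝 L)) :
    Lp ≤ 2 * (1 + ε') * L + 8 * δ ^ 2 / (σ - 1) ^ 2 * ∫ x in Ioi 1,
      (deriv (fun τ => φ τ x) 0 ^ 2 + deriv (φ 0) x ^ 2 + P x * φ 0 x ^ 2) :=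
  le_of_tendsto_of_tendsto hLp ((hL.const_mul _).add_const _) (Eventually.of_forall fun t =>
    (wave1D_far_duhamel_comparison_abs hV₀ hV₀0 hP hP0 hφ hFφ hφsol hFφ0 hφ₀ hF₀ hφ₀sol hF₀0
      hdata hδ hσ hε' hq hVP hfin t).2)

end

/-- **Splitting of lower Lebesgue exterior energies**: `∫⁻ e[ψ − k] ≤ 2∫⁻ e[ψ] + 2∫⁻ e[k]` on any
set, for `C²` functions `ψ, k` and `V ≥ 0` continuous. [folklore] -/
theorem wave1D_energy_lintegral_sub_le {V : ℝ → ℝ} (hV : Continuous V) (hV0 : ∀ x, 0 ≤ V x)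
    {ψ k : ℝ → ℝ → ℝ} (hψ : ContDiff ℝ 2 (Function.uncurry ψ))
    (hk : ContDiff ℝ 2 (Function.uncurry k)) (s : Set ℝ) (t : ℝ) :
    ∫⁻ x in s, ENNReal.ofReal
        (deriv (fun τ => ψ τ x - k τ x) t ^ 2 + deriv (fun y => ψ t y - k t y) x ^ 2
          + V x * (ψ t x - k t x) ^ 2)
      ≤ (2 * ∫⁻ x in s, ENNReal.ofReal
          (deriv (fun τ => ψ τ x) t ^ 2 + deriv (ψ t) x ^ 2 + V x * ψ t x ^ 2))
        + 2 * ∫⁻ x in s, ENNReal.ofReal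
          (deriv (fun τ => k τ x) t ^ 2 + deriv (k t) x ^ 2 + V x * k t x ^ 2) := by
  have hd : ∀ (φ : ℝ → ℝ → ℝ), ContDiff ℝ 2 (Function.uncurry φ) → ∀ x,
      DifferentiableAt ℝ (fun τ => φ τ x) t ∧ DifferentiableAt ℝ (φ t) x := fun φ hφ x =>
    ⟨(contDiff_two_slices' hφ t x).1.differentiable (by norm_num) t,
      (contDiff_two_slices' hφ t x).2.differentiable (by norm_num) x⟩
  have hpt : ∀ x, ENNReal.ofReal
      (deriv (fun τ => ψ τ x - k τ x) t ^ 2 + deriv (fun y => ψ t y - k t y) x ^ 2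
        + V x * (ψ t x - k t x) ^ 2)
      ≤ 2 * ENNReal.ofReal (deriv (fun τ => ψ τ x) t ^ 2 + deriv (ψ t) x ^ 2 + V x * ψ t x ^ 2)
        + 2 * ENNReal.ofReal (deriv (fun τ => k τ x) t ^ 2 + deriv (k t) x ^ 2
          + V x * k t x ^ 2) := by
    intro x
    rw [deriv_fun_sub (hd ψ hψ x).1 (hd k hk x).1, deriv_fun_sub (hd ψ hψ x).2 (hd k hk x).2]
    have hVx := hV0 x
    have e2 : (2 : ENNReal) = ENNReal.ofReal 2 := by simp
    rw [e2, ← ENNReal.ofReal_mul (by norm_num), ← ENNReal.ofReal_mul (by norm_num),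
      ← ENNReal.ofReal_add (by positivity) (by positivity)]
    refine ENNReal.ofReal_le_ofReal ?_
    nlinarith [sq_nonneg (deriv (fun τ => ψ τ x) t + deriv (fun τ => k τ x) t),
      sq_nonneg (deriv (ψ t) x + deriv (k t) x), mul_nonneg hVx (sq_nonneg (ψ t x + k t x))]
  have hm1 : Measurable fun x => ENNReal.ofReal
      (deriv (fun τ => ψ τ x) t ^ 2 + deriv (ψ t) x ^ 2 + V x * ψ t x ^ 2) :=
    ((continuous_wave1D_energyDensity hV hψ).comp
      (continuous_const.prodMk continuous_id)).measurable.ennreal_ofReal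
  calc ∫⁻ x in s, ENNReal.ofReal
        (deriv (fun τ => ψ τ x - k τ x) t ^ 2 + deriv (fun y => ψ t y - k t y) x ^ 2
          + V x * (ψ t x - k t x) ^ 2)
      ≤ ∫⁻ x in s, (2 * ENNReal.ofReal (deriv (fun τ => ψ τ x) t ^ 2 + deriv (ψ t) x ^ 2
          + V x * ψ t x ^ 2)
        + 2 * ENNReal.ofReal (deriv (fun τ => k τ x) t ^ 2 + deriv (k t) x ^ 2
          + V x * k t x ^ 2)) := lintegral_mono hpt
    _ = (2 * ∫⁻ x in s, ENNReal.ofReal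
          (deriv (fun τ => ψ τ x) t ^ 2 + deriv (ψ t) x ^ 2 + V x * ψ t x ^ 2))
        + 2 * ∫⁻ x in s, ENNReal.ofReal
          (deriv (fun τ => k τ x) t ^ 2 + deriv (k t) x ^ 2 + V x * k t x ^ 2) := by
        rw [lintegral_add_left (hm1.const_mul 2), lintegral_const_mul _ hm1,
          lintegral_const_mul' _ _ (by simp)]

end Literature.Analysis.PDE
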